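import Literature.NumberTheory.GaloisCohomology.RestrictedRamificationPoitouTateThreeLeTotallyComplex
import Literature.NumberTheory.GaloisCohomology.RestrictedRamificationFiniteCohomologyOfTateEuler
import Literature.NumberTheory.GaloisRepresentations.ContinuousCohomologySESEulerIdentity
import HarnessLib

/-!
# Milne I Lemma 5.3 at a totally complex number field: Tate's Euler-characteristic identity is
# two-out-of-three along short exact sequences of `G_S`-modules (`H³(G_S, ·) = 0` from `cd_p G_S ≤ 2`)

Topic `NumberTheory/GaloisCohomology`; namespace `Literature.NumberTheory.GaloisCohomology`.
THEOREMS ONLY (no definition, no named fact, no `sorry`, no instance; D-0026).  Lane «TATE-EPC-TC»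
of cell `bsd-eis` (road memo `TATE-EPC-TC-ROAD-w5g7.md`, evidence #54 on
stmt-BirchSwinnertonDyer-19032), brick (B1d) — the number-field instance of the generic files
`GaloisRepresentations/ContinuousCohomologySESFiniteness.lean` and
`GaloisRepresentations/ContinuousCohomologySESEulerIdentity.lean`.

Milne, *Arithmetic Duality Theorems*, I §5 (proof of Thm. 5.1, p. 69): "LEMMA 5.3. The map `φ` …
is multiplicative in short exact sequences", where `φ(M) = χ(G_S, M)·∏_{v arch} |#M|_v / …` and
`χ(G_S, M) = #H⁰·#H²/#H¹`; in print this uses (4.10) (`Hʳ(G_S, M) ≅ ⊕_{v real} Hʳ(K_v, M)`,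
`r ≥ 3`).  At a TOTALLY COMPLEX `K` and for `S ⊇ S_p`, the tree PROVES `cd_p(G_{K,S}) ≤ 2`
(`groupCdLE_two_galoisGroupUnramifiedOutside_of_isTotallyComplex`, NSW (8.3.18), lane PT3-TC), so
`H³(G_S, M₁) = 0` for `p`-primary `M₁` and the nine-term sequence `0 → H⁰(M₁) → ⋯ → H²(M₃) → 0` is
exact: Tate's identity (in its totally imaginary form `#H⁰(G_S, M)·#H²(G_S, M)·#M^e = #H¹(G_S, M)`,
`e = r₂(K)`, cf. `natCard_restrictedCohomology_euler_of_forall_isComplex`) holds for any one of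
`M₁, M₂, M₃` as soon as it holds for the other two.  This is the dévissage step of the lane
("induction on `#M` through `0 → M′ → M → M″ → 0`"; bricks B0, B3b, B8 consume it).

## What is here (`K` totally complex, `S ⊇ S_p`, `p` prime)

* §1 `subsingleton_continuousCohomology_of_isPrimaryTorsion_of_isTotallyComplex`,
  `subsingleton_restrictedCohomology_of_isPrimaryTorsion_of_isTotallyComplex` — **`H^q(G_{K,S}, A) = 0`
  for `q ≥ 3` and `p`-primary `A`**, in both tree currencies (`ContinuousRep (GaloisGroupUnramifiedOutside K S) ℤ A`
  and `restrictedCohomology ρ S q` of a discrete `Γ_K`-module), PT3-TC's theorem read through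
  `GroupCdLE` / `subsingleton_restrictedCohomology_of_isPrimaryTorsion` (no real places, so no
  parity condition on `p`).
* §2 the passage `Γ_K ↦ G_S`: a short exact sequence `0 → M₁ → M₂ → M₃ → 0` of discrete `Γ_K`-modules
  (`IsSES f g`) with `M₂` unramified outside `S` gives `M₁`, `M₃` unramified outside `S`
  (`isUnramifiedOutside_X₁/X₃`) and a short exact sequence of the `G_S`-modules `Mᵢ^{N_S} = Mᵢ`
  (`isSES_invariantsHom_ramificationSubgroup`; `#Mᵢ^{N_S} = #Mᵢ`, `natCard_invariantsOf_ramificationSubgroup`);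
  the unfolding `restrictedCohomology_euler_iff` between the two spellings of the identity.
* §3 **the two-out-of-three theorems** `restrictedCohomology_euler_X₂ / _X₃ / _X₁`: for `S` FINITE,
  `M₂`, `M₃` finite, `M₁` `p`-primary and any exponent `e : ℕ`, two of the identities
  `#H⁰(G_S, Mᵢ)·#H²(G_S, Mᵢ)·#Mᵢ^e = #H¹(G_S, Mᵢ)` (`Hⁿ(G_S, M) = restrictedCohomology ρ S n`) give the
  third — with NO finiteness hypothesis on the `H²` (an identity with `#H¹ ≠ 0` on the right forces
  `#H² ≠ 0`, `finite_restrictedCohomology_two_of_euler`; `H¹(G_S, M)` is finite unconditionally,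
  `finite_restrictedCohomology_one`); and the same in `ContinuousRep (GaloisGroupUnramifiedOutside K S) ℤ A`
  currency (`continuousCohomology_euler_X₂_of_isTotallyComplex`).

## What is NOT here
No proof of Tate's formula itself (bricks B2–B9 of the lane), no finiteness of `H²(G_S, M)` beyond
what an assumed identity forces (bricks B1a–B1c), nothing at a field with a real place.

## References
* J. S. Milne, *Arithmetic Duality Theorems*, 2nd ed. (2006), I §5 Thm. 5.1 and Lemma 5.3 (p. 69),
  I §2 Thm. 2.8 (proof). [MilneADT2006]
* J. Neukirch, A. Schmidt, K. Wingberg, *Cohomology of Number Fields*, 2nd ed. (2008), (8.3.18),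
  (8.7.4). [NeukirchSchmidtWingberg2008]
* D. Harari, *Galois Cohomology and Class Field Theory* (2020), Cor. 17.14, Def. 15.36, Remark 17.7 (b).
  [Harari2020]
-/

noncomputable section

open CategoryTheory Function NumberField Field IsDedekindDomain
open scoped NumberField

namespace Literature.NumberTheory.GaloisCohomology

open Literature.NumberTheory.GaloisRepresentations
open Literature.NumberTheory.GaloisRepresentations.DiscreteGaloisModule (restrictedCohomology)
open _root_.TopRep _root_.ContRepresentation _root_.ContinuousCohomology

variable {K : Type} [Field K] [NumberField K]

/-! ### §1. `H^q(G_{K,S}, A) = 0`, `q ≥ 3`, `A` `p`-primary, `K` totally complex, `S ⊇ S_p` -/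

section Vanishing

omit [NumberField K] in
/-- A totally complex field has no real place, so the parity proviso "`p ≠ 2` if `K` has a real
place" of `cd_p(G_S) ≤ 2` is void. [cite: Harari2020, Cor. 17.14 (p. 295)] -/
theorem ne_two_of_exists_isReal_of_isTotallyComplex [NumberField K] [IsTotallyComplex K] {p : ℕ} :
    (∃ w : InfinitePlace K, w.IsReal) → p ≠ 2 := fun ⟨w, hw⟩ =>
  absurd hw (InfinitePlace.not_isReal_iff_isComplex.2 (IsTotallyComplex.isComplex w))

/-- **`H^q(G_{K,S}, A) = 0` for `q ≥ 3`**, `K` totally complex, `S ∋` every place above the prime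
`p`, `A` a discrete `p`-primary `G_{K,S}`-module (`ContinuousRep (GaloisGroupUnramifiedOutside K S) ℤ A`
currency): `cd_p(G_{K,S}) ≤ 2` (NSW (8.3.18), the tree's
`groupCdLE_two_galoisGroupUnramifiedOutside_of_isTotallyComplex`).
[cite: NeukirchSchmidtWingberg2008, (8.3.18)] [cite: Harari2020, Cor. 17.14 (p. 295)] -/
theorem subsingleton_continuousCohomology_of_isPrimaryTorsion_of_isTotallyComplex [IsTotallyComplex K]
    (S : Set (HeightOneSpectrum (𝓞 K))) (p : ℕ) [Fact p.Prime]
    (hSp : ∀ v : HeightOneSpectrum (𝓞 K), ((p : ℕ) : 𝓞 K) ∈ v.asIdeal → v ∈ S)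
    {A : Type} [AddCommGroup A] [TopologicalSpace A] [DiscreteTopology A]
    (τ : ContinuousRep (GaloisGroupUnramifiedOutside K S) ℤ A) (hA : IsPrimaryTorsion p A)
    {q : ℕ} (hq : 2 < q) : Subsingleton (continuousCohomology q τ.toTopRep) :=
  groupCdLE_two_galoisGroupUnramifiedOutside_of_isTotallyComplex (K := K) S p hSp
    ne_two_of_exists_isReal_of_isTotallyComplex A τ hA hq

/-- **`H^q(G_S, M^{N_S}) = 0` for `q ≥ 3`** (`restrictedCohomology` currency), `K` totally complex,
`S ∋` every place above `p`, `M` a discrete `p`-primary `Γ_K`-module (any cardinality).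
[cite: NeukirchSchmidtWingberg2008, (8.3.18)] [cite: Harari2020, Cor. 17.14 (p. 295)] -/
theorem subsingleton_restrictedCohomology_of_isPrimaryTorsion_of_isTotallyComplex [IsTotallyComplex K]
    (S : Set (HeightOneSpectrum (𝓞 K))) (p : ℕ) [Fact p.Prime]
    (hSp : ∀ v : HeightOneSpectrum (𝓞 K), ((p : ℕ) : 𝓞 K) ∈ v.asIdeal → v ∈ S)
    {M : Type} [AddCommGroup M] [TopologicalSpace M] [DiscreteTopology M]
    (ρ : DiscreteGaloisModule K M) (hM : IsPrimaryTorsion p M) {q : ℕ} (hq : 2 < q) :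
    Subsingleton (restrictedCohomology ρ S q) :=
  subsingleton_restrictedCohomology_of_isPrimaryTorsion
    (groupCdLE_two_galoisGroupUnramifiedOutside_of_isTotallyComplex (K := K)) S p hSp
    ne_two_of_exists_isReal_of_isTotallyComplex ρ hM hq

end Vanishing

/-! ### §2. From `Γ_K`-modules unramified outside `S` to `G_S`-modules -/

section Passage

variable {M₁ M₂ M₃ : Type}
  [AddCommGroup M₁] [TopologicalSpace M₁] [DiscreteTopology M₁]
  [AddCommGroup M₂] [TopologicalSpace M₂] [DiscreteTopology M₂]
  [AddCommGroup M₃] [TopologicalSpace M₃] [DiscreteTopology M₃]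
  {ρ₁ : DiscreteGaloisModule K M₁} {ρ₂ : DiscreteGaloisModule K M₂} {ρ₃ : DiscreteGaloisModule K M₃}
  {f : ρ₁.toTopRep ⟶ ρ₂.toTopRep} {g : ρ₂.toTopRep ⟶ ρ₃.toTopRep}

omit [NumberField K] in
/-- `N_S` acts trivially on a module unramified outside `S` (element form of
`isUnramifiedOutside_iff_ramificationSubgroup_le_ker`). [cite: Harari2020, Remark 17.7 (b) and Def. 15.36] -/
theorem apply_eq_of_isUnramifiedOutside (ρ : DiscreteGaloisModule K M₂) (S : Set (HeightOneSpectrum (𝓞 K)))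
    (hur : GaloisRep.IsUnramifiedOutside S ρ) :
    ∀ n ∈ ramificationSubgroup K S, ∀ y : M₂, ρ n y = y := fun n hn y => by
  have hg : ρ n = LinearMap.id :=
    (ContinuousRep.mem_ker ρ n).1 ((ρ.isUnramifiedOutside_iff_ramificationSubgroup_le_ker S).1 hur hn)
  rw [hg, LinearMap.id_apply]

omit [NumberField K] in
/-- In a short exact sequence of discrete `Γ_K`-modules with `M₂` unramified outside `S`, **`M₁` is
unramified outside `S`**. [cite: Harari2020, Remark 17.7 (b)] -/
theorem isUnramifiedOutside_X₁ (h : IsSES f g) (S : Set (HeightOneSpectrum (𝓞 K)))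
    (hur : GaloisRep.IsUnramifiedOutside S ρ₂) : GaloisRep.IsUnramifiedOutside S ρ₁ :=
  (ρ₁.isUnramifiedOutside_iff_ramificationSubgroup_le_ker S).2 fun n hn =>
    (ContinuousRep.mem_ker ρ₁ n).2 (LinearMap.ext fun x =>
      h.apply_eq_X₁_of_X₂ (N := ramificationSubgroup K S) (apply_eq_of_isUnramifiedOutside ρ₂ S hur)
        n hn x)

omit [NumberField K] in
/-- In a short exact sequence of discrete `Γ_K`-modules with `M₂` unramified outside `S`, **`M₃` is
unramified outside `S`**. [cite: Harari2020, Remark 17.7 (b)] -/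
theorem isUnramifiedOutside_X₃ (h : IsSES f g) (S : Set (HeightOneSpectrum (𝓞 K)))
    (hur : GaloisRep.IsUnramifiedOutside S ρ₂) : GaloisRep.IsUnramifiedOutside S ρ₃ :=
  (ρ₃.isUnramifiedOutside_iff_ramificationSubgroup_le_ker S).2 fun n hn =>
    (ContinuousRep.mem_ker ρ₃ n).2 (LinearMap.ext fun v =>
      h.apply_eq_X₃_of_X₂ (N := ramificationSubgroup K S) (apply_eq_of_isUnramifiedOutside ρ₂ S hur)
        n hn v)

omit [NumberField K] in
/-- **The `G_S`-modules `Mᵢ^{N_S}` of a short exact sequence of discrete `Γ_K`-modules with `M₂`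
unramified outside `S` form a short exact sequence** (`IsSES` of `ContinuousRep.invariantsHom`;
`DiscreteGaloisModule.quotientInvariants ρ N_S` is `ContinuousRep.quotientInvariants N_S ρ` by `rfl`,
so `restrictedCohomology ρᵢ S n` is literally the continuous cohomology of these).
[cite: Harari2020, Def. 15.36 and Remark 17.7 (b)] -/
theorem isSES_invariantsHom_ramificationSubgroup (h : IsSES f g) (S : Set (HeightOneSpectrum (𝓞 K)))
    (hur : GaloisRep.IsUnramifiedOutside S ρ₂) :
    IsSES (ContinuousRep.invariantsHom (N := ramificationSubgroup K S) f)
      (ContinuousRep.invariantsHom (N := ramificationSubgroup K S) g) :=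
  h.invariantsHom (apply_eq_of_isUnramifiedOutside ρ₂ S hur)

omit [NumberField K] in
/-- **`#M^{N_S} = #M`** for `M` unramified outside `S` (`M^{N_S} = M`, `invariantsRamificationEquiv`).
[cite: Harari2020, Def. 15.36 and Remark 17.7 (b)] -/
theorem natCard_invariantsOf_ramificationSubgroup (ρ : DiscreteGaloisModule K M₂)
    (S : Set (HeightOneSpectrum (𝓞 K))) (hur : GaloisRep.IsUnramifiedOutside S ρ) :
    Nat.card (ContinuousRep.invariantsOf (ramificationSubgroup K S) ρ) = Nat.card M₂ :=
  Nat.card_congr (ρ.invariantsRamificationEquiv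
    ((ρ.isUnramifiedOutside_iff_ramificationSubgroup_le_ker S).1 hur)).toEquiv

omit [NumberField K] in
/-- **Unfolding**: the identity `#H⁰(G_S, M)·#H²(G_S, M)·#M^e = #H¹(G_S, M)` in `restrictedCohomology`
currency is the identity `#H⁰·#H²·#(M^{N_S})^e = #H¹` for the continuous cohomology of the
`G_S`-module `M^{N_S}` (`ContinuousRep.quotientInvariants`), for `M` unramified outside `S`.
[cite: MilneADT2006, I §5 Thm. 5.1 (p. 67)] [cite: Harari2020, Def. 15.36] -/
theorem restrictedCohomology_euler_iff (ρ : DiscreteGaloisModule K M₂) (S : Set (HeightOneSpectrum (𝓞 K)))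
    (hur : GaloisRep.IsUnramifiedOutside S ρ) (e : ℕ) :
    Nat.card (restrictedCohomology ρ S 0) * Nat.card (restrictedCohomology ρ S 2) * Nat.card M₂ ^ e =
        Nat.card (restrictedCohomology ρ S 1) ↔
      Nat.card (continuousCohomology 0
            (ContinuousRep.quotientInvariants (ramificationSubgroup K S) ρ).toTopRep) *
          Nat.card (continuousCohomology 2
            (ContinuousRep.quotientInvariants (ramificationSubgroup K S) ρ).toTopRep) *
          Nat.card (ContinuousRep.invariantsOf (ramificationSubgroup K S) ρ) ^ e =
        Nat.card (continuousCohomology 1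
          (ContinuousRep.quotientInvariants (ramificationSubgroup K S) ρ).toTopRep) := by
  rw [natCard_invariantsOf_ramificationSubgroup ρ S hur]
  exact Iff.rfl

/-- **An assumed identity forces `H²` to be finite**: if `S` is finite, `M` finite and
`#H⁰(G_S, M)·#H²(G_S, M)·#M^e = #H¹(G_S, M)`, then `H²(G_S, M)` is finite (`H¹(G_S, M)` is finite
and non-empty, so the right-hand side is `≠ 0`; the `Nat.card` of an infinite type is `0`).
[cite: MilneADT2006, I §5 Thm. 5.1 (p. 67) and Cor. 4.15 (p. 61)] -/
theorem finite_restrictedCohomology_two_of_euler [Finite M₂] {S : Set (HeightOneSpectrum (𝓞 K))}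
    (hSfin : S.Finite) (ρ : DiscreteGaloisModule K M₂) {e : ℕ}
    (hE : Nat.card (restrictedCohomology ρ S 0) * Nat.card (restrictedCohomology ρ S 2) * Nat.card M₂ ^ e =
      Nat.card (restrictedCohomology ρ S 1)) :
    Finite (restrictedCohomology ρ S 2) := by
  haveI := finite_restrictedCohomology_one hSfin ρ
  refine Nat.finite_of_card_ne_zero fun h0 => ?_
  rw [h0, mul_zero, zero_mul] at hE
  exact (Nat.card_pos (α := restrictedCohomology ρ S 1)).ne' hE.symm

end Passage

/-! ### §3. Two out of three for Tate's identity along a short exact sequence (`K` totally complex) -/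

section TwoOutOfThree

variable [IsTotallyComplex K] {S : Set (HeightOneSpectrum (𝓞 K))}
variable {M₁ M₂ M₃ : Type}
  [AddCommGroup M₁] [TopologicalSpace M₁] [DiscreteTopology M₁]
  [AddCommGroup M₂] [TopologicalSpace M₂] [DiscreteTopology M₂]
  [AddCommGroup M₃] [TopologicalSpace M₃] [DiscreteTopology M₃]

/-- **Middle term** (Milne I Lemma 5.3, dévissage form): `K` totally complex, `S ⊇ S_p` finite,
`0 → M₁ → M₂ → M₃ → 0` a short exact sequence of discrete `Γ_K`-modules with `M₂` finite and
unramified outside `S`, `M₃` finite, `M₁` `p`-primary.  If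
`#H⁰(G_S, Mᵢ)·#H²(G_S, Mᵢ)·#Mᵢ^e = #H¹(G_S, Mᵢ)` holds for `i = 1` and `i = 3`, it holds for `i = 2`
(`Hⁿ(G_S, M) = restrictedCohomology ρ S n`, any `e : ℕ`; `e = r₂(K)` is Tate's).
[cite: MilneADT2006, I §5 Lemma 5.3 (p. 69)] [cite: NeukirchSchmidtWingberg2008, (8.3.18)] -/
theorem restrictedCohomology_euler_X₂ (hSfin : S.Finite) (p : ℕ) [Fact p.Prime]
    (hSp : ∀ v : HeightOneSpectrum (𝓞 K), ((p : ℕ) : 𝓞 K) ∈ v.asIdeal → v ∈ S)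
    [Finite M₂] [Finite M₃]
    {ρ₁ : DiscreteGaloisModule K M₁} {ρ₂ : DiscreteGaloisModule K M₂} {ρ₃ : DiscreteGaloisModule K M₃}
    {f : ρ₁.toTopRep ⟶ ρ₂.toTopRep} {g : ρ₂.toTopRep ⟶ ρ₃.toTopRep} (h : IsSES f g)
    (hur : GaloisRep.IsUnramifiedOutside S ρ₂) (hM₁ : IsPrimaryTorsion p M₁) (e : ℕ)
    (h₁ : Nat.card (restrictedCohomology ρ₁ S 0) * Nat.card (restrictedCohomology ρ₁ S 2) *
        Nat.card M₁ ^ e = Nat.card (restrictedCohomology ρ₁ S 1))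
    (h₃ : Nat.card (restrictedCohomology ρ₃ S 0) * Nat.card (restrictedCohomology ρ₃ S 2) *
        Nat.card M₃ ^ e = Nat.card (restrictedCohomology ρ₃ S 1)) :
    Nat.card (restrictedCohomology ρ₂ S 0) * Nat.card (restrictedCohomology ρ₂ S 2) *
        Nat.card M₂ ^ e = Nat.card (restrictedCohomology ρ₂ S 1) := by
  haveI : Finite M₁ := Finite.of_injective _ h.injective
  have hur₁ := isUnramifiedOutside_X₁ h S hur
  have hur₃ := isUnramifiedOutside_X₃ h S hur
  have hS := isSES_invariantsHom_ramificationSubgroup h S hur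
  haveI : Subsingleton (continuousCohomology 3
      (ContinuousRep.quotientInvariants (ramificationSubgroup K S) ρ₁).toTopRep) :=
    subsingleton_restrictedCohomology_of_isPrimaryTorsion_of_isTotallyComplex S p hSp ρ₁ hM₁
      (by norm_num)
  haveI : Finite (continuousCohomology 1
      (ContinuousRep.quotientInvariants (ramificationSubgroup K S) ρ₁).toTopRep) :=
    finite_restrictedCohomology_one hSfin ρ₁
  haveI : Finite (continuousCohomology 1
      (ContinuousRep.quotientInvariants (ramificationSubgroup K S) ρ₂).toTopRep) :=
    finite_restrictedCohomology_one hSfin ρ₂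
  haveI : Finite (continuousCohomology 1
      (ContinuousRep.quotientInvariants (ramificationSubgroup K S) ρ₃).toTopRep) :=
    finite_restrictedCohomology_one hSfin ρ₃
  haveI : Finite (continuousCohomology 2
      (ContinuousRep.quotientInvariants (ramificationSubgroup K S) ρ₁).toTopRep) :=
    finite_restrictedCohomology_two_of_euler hSfin ρ₁ h₁
  haveI : Finite (continuousCohomology 2
      (ContinuousRep.quotientInvariants (ramificationSubgroup K S) ρ₃).toTopRep) :=
    finite_restrictedCohomology_two_of_euler hSfin ρ₃ h₃
  haveI : Finite (continuousCohomology 2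
      (ContinuousRep.quotientInvariants (ramificationSubgroup K S) ρ₂).toTopRep) :=
    hS.finite_two_X₂
  exact (restrictedCohomology_euler_iff ρ₂ S hur e).2
    (hS.euler_X₂ e ((restrictedCohomology_euler_iff ρ₁ S hur₁ e).1 h₁)
      ((restrictedCohomology_euler_iff ρ₃ S hur₃ e).1 h₃))

/-- **Right term**: under the same standing hypotheses, the identity for `M₁` and `M₂` gives it
for `M₃`. [cite: MilneADT2006, I §5 Lemma 5.3 (p. 69)] [cite: NeukirchSchmidtWingberg2008, (8.3.18)] -/
theorem restrictedCohomology_euler_X₃ (hSfin : S.Finite) (p : ℕ) [Fact p.Prime]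
    (hSp : ∀ v : HeightOneSpectrum (𝓞 K), ((p : ℕ) : 𝓞 K) ∈ v.asIdeal → v ∈ S)
    [Finite M₂] [Finite M₃]
    {ρ₁ : DiscreteGaloisModule K M₁} {ρ₂ : DiscreteGaloisModule K M₂} {ρ₃ : DiscreteGaloisModule K M₃}
    {f : ρ₁.toTopRep ⟶ ρ₂.toTopRep} {g : ρ₂.toTopRep ⟶ ρ₃.toTopRep} (h : IsSES f g)
    (hur : GaloisRep.IsUnramifiedOutside S ρ₂) (hM₁ : IsPrimaryTorsion p M₁) (e : ℕ)
    (h₁ : Nat.card (restrictedCohomology ρ₁ S 0) * Nat.card (restrictedCohomology ρ₁ S 2) *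
        Nat.card M₁ ^ e = Nat.card (restrictedCohomology ρ₁ S 1))
    (h₂ : Nat.card (restrictedCohomology ρ₂ S 0) * Nat.card (restrictedCohomology ρ₂ S 2) *
        Nat.card M₂ ^ e = Nat.card (restrictedCohomology ρ₂ S 1)) :
    Nat.card (restrictedCohomology ρ₃ S 0) * Nat.card (restrictedCohomology ρ₃ S 2) *
        Nat.card M₃ ^ e = Nat.card (restrictedCohomology ρ₃ S 1) := by
  haveI : Finite M₁ := Finite.of_injective _ h.injective
  have hur₁ := isUnramifiedOutside_X₁ h S hur
  have hur₃ := isUnramifiedOutside_X₃ h S hur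
  have hS := isSES_invariantsHom_ramificationSubgroup h S hur
  haveI : Subsingleton (continuousCohomology 3
      (ContinuousRep.quotientInvariants (ramificationSubgroup K S) ρ₁).toTopRep) :=
    subsingleton_restrictedCohomology_of_isPrimaryTorsion_of_isTotallyComplex S p hSp ρ₁ hM₁
      (by norm_num)
  haveI : Finite (continuousCohomology 1
      (ContinuousRep.quotientInvariants (ramificationSubgroup K S) ρ₁).toTopRep) :=
    finite_restrictedCohomology_one hSfin ρ₁
  haveI : Finite (continuousCohomology 1
      (ContinuousRep.quotientInvariants (ramificationSubgroup K S) ρ₂).toTopRep) :=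
    finite_restrictedCohomology_one hSfin ρ₂
  haveI : Finite (continuousCohomology 1
      (ContinuousRep.quotientInvariants (ramificationSubgroup K S) ρ₃).toTopRep) :=
    finite_restrictedCohomology_one hSfin ρ₃
  haveI : Finite (continuousCohomology 2
      (ContinuousRep.quotientInvariants (ramificationSubgroup K S) ρ₁).toTopRep) :=
    finite_restrictedCohomology_two_of_euler hSfin ρ₁ h₁
  haveI : Finite (continuousCohomology 2
      (ContinuousRep.quotientInvariants (ramificationSubgroup K S) ρ₂).toTopRep) :=
    finite_restrictedCohomology_two_of_euler hSfin ρ₂ h₂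
  exact (restrictedCohomology_euler_iff ρ₃ S hur₃ e).2
    (hS.euler_X₃ e ((restrictedCohomology_euler_iff ρ₁ S hur₁ e).1 h₁)
      ((restrictedCohomology_euler_iff ρ₂ S hur e).1 h₂))

/-- **Left term**: under the same standing hypotheses, the identity for `M₂` and `M₃` gives it
for `M₁`. [cite: MilneADT2006, I §5 Lemma 5.3 (p. 69)] [cite: NeukirchSchmidtWingberg2008, (8.3.18)] -/
theorem restrictedCohomology_euler_X₁ (hSfin : S.Finite) (p : ℕ) [Fact p.Prime]
    (hSp : ∀ v : HeightOneSpectrum (𝓞 K), ((p : ℕ) : 𝓞 K) ∈ v.asIdeal → v ∈ S)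
    [Finite M₂] [Finite M₃]
    {ρ₁ : DiscreteGaloisModule K M₁} {ρ₂ : DiscreteGaloisModule K M₂} {ρ₃ : DiscreteGaloisModule K M₃}
    {f : ρ₁.toTopRep ⟶ ρ₂.toTopRep} {g : ρ₂.toTopRep ⟶ ρ₃.toTopRep} (h : IsSES f g)
    (hur : GaloisRep.IsUnramifiedOutside S ρ₂) (hM₁ : IsPrimaryTorsion p M₁) (e : ℕ)
    (h₂ : Nat.card (restrictedCohomology ρ₂ S 0) * Nat.card (restrictedCohomology ρ₂ S 2) *
        Nat.card M₂ ^ e = Nat.card (restrictedCohomology ρ₂ S 1))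
    (h₃ : Nat.card (restrictedCohomology ρ₃ S 0) * Nat.card (restrictedCohomology ρ₃ S 2) *
        Nat.card M₃ ^ e = Nat.card (restrictedCohomology ρ₃ S 1)) :
    Nat.card (restrictedCohomology ρ₁ S 0) * Nat.card (restrictedCohomology ρ₁ S 2) *
        Nat.card M₁ ^ e = Nat.card (restrictedCohomology ρ₁ S 1) := by
  haveI : Finite M₁ := Finite.of_injective _ h.injective
  have hur₁ := isUnramifiedOutside_X₁ h S hur
  have hur₃ := isUnramifiedOutside_X₃ h S hur
  have hS := isSES_invariantsHom_ramificationSubgroup h S hur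
  haveI : Subsingleton (continuousCohomology 3
      (ContinuousRep.quotientInvariants (ramificationSubgroup K S) ρ₁).toTopRep) :=
    subsingleton_restrictedCohomology_of_isPrimaryTorsion_of_isTotallyComplex S p hSp ρ₁ hM₁
      (by norm_num)
  haveI : Finite (continuousCohomology 1
      (ContinuousRep.quotientInvariants (ramificationSubgroup K S) ρ₁).toTopRep) :=
    finite_restrictedCohomology_one hSfin ρ₁
  haveI : Finite (continuousCohomology 1
      (ContinuousRep.quotientInvariants (ramificationSubgroup K S) ρ₂).toTopRep) :=
    finite_restrictedCohomology_one hSfin ρ₂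
  haveI : Finite (continuousCohomology 1
      (ContinuousRep.quotientInvariants (ramificationSubgroup K S) ρ₃).toTopRep) :=
    finite_restrictedCohomology_one hSfin ρ₃
  haveI : Finite (continuousCohomology 2
      (ContinuousRep.quotientInvariants (ramificationSubgroup K S) ρ₂).toTopRep) :=
    finite_restrictedCohomology_two_of_euler hSfin ρ₂ h₂
  haveI : Finite (continuousCohomology 2
      (ContinuousRep.quotientInvariants (ramificationSubgroup K S) ρ₃).toTopRep) :=
    finite_restrictedCohomology_two_of_euler hSfin ρ₃ h₃
  haveI : Finite (continuousCohomology 2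
      (ContinuousRep.quotientInvariants (ramificationSubgroup K S) ρ₁).toTopRep) :=
    hS.finite_two_X₁
  exact (restrictedCohomology_euler_iff ρ₁ S hur₁ e).2
    (hS.euler_X₁ e ((restrictedCohomology_euler_iff ρ₂ S hur e).1 h₂)
      ((restrictedCohomology_euler_iff ρ₃ S hur₃ e).1 h₃))

end TwoOutOfThree

/-! ### §4. The same in `ContinuousRep (GaloisGroupUnramifiedOutside K S) ℤ A` currency -/

section GSCurrency

variable [IsTotallyComplex K] (S : Set (HeightOneSpectrum (𝓞 K)))
variable {A₁ A₂ A₃ : Type}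
  [AddCommGroup A₁] [TopologicalSpace A₁] [DiscreteTopology A₁]
  [AddCommGroup A₂] [TopologicalSpace A₂] [DiscreteTopology A₂]
  [AddCommGroup A₃] [TopologicalSpace A₃] [DiscreteTopology A₃]
  {τ₁ : ContinuousRep (GaloisGroupUnramifiedOutside K S) ℤ A₁}
  {τ₂ : ContinuousRep (GaloisGroupUnramifiedOutside K S) ℤ A₂}
  {τ₃ : ContinuousRep (GaloisGroupUnramifiedOutside K S) ℤ A₃}
  {f : τ₁.toTopRep ⟶ τ₂.toTopRep} {g : τ₂.toTopRep ⟶ τ₃.toTopRep}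

/-- **Middle term, `G_{K,S}`-representation currency**: `K` totally complex, `S ⊇ S_p`,
`0 → A₁ → A₂ → A₃ → 0` a short exact sequence of discrete `G_{K,S}`-modules, `A₂`, `A₃` finite,
`A₁` `p`-primary, `H¹(G_{K,S}, Aᵢ)` finite (`i = 1, 2, 3`; automatic for `S` finite,
`ContinuousRep.finite_continuousCohomology_one`) and `H²(G_{K,S}, A₁)`, `H²(G_{K,S}, A₂)` finite:
the identities `#H⁰·#H²·#Aᵢ^e = #H¹` for `i = 1, 3` give it for `i = 2` — `IsSES.euler_X₂` with
`H³(G_{K,S}, A₁) = 0` discharged. [cite: MilneADT2006, I §5 Lemma 5.3 (p. 69)]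
[cite: NeukirchSchmidtWingberg2008, (8.3.18)] -/
theorem continuousCohomology_euler_X₂_of_isTotallyComplex (p : ℕ) [Fact p.Prime]
    (hSp : ∀ v : HeightOneSpectrum (𝓞 K), ((p : ℕ) : 𝓞 K) ∈ v.asIdeal → v ∈ S)
    (h : IsSES f g) (hA₁ : IsPrimaryTorsion p A₁) [Finite A₂] [Finite A₃]
    [Finite (continuousCohomology 1 τ₁.toTopRep)] [Finite (continuousCohomology 1 τ₂.toTopRep)]
    [Finite (continuousCohomology 1 τ₃.toTopRep)] [Finite (continuousCohomology 2 τ₁.toTopRep)]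
    [Finite (continuousCohomology 2 τ₂.toTopRep)] (e : ℕ)
    (h₁ : Nat.card (continuousCohomology 0 τ₁.toTopRep) * Nat.card (continuousCohomology 2 τ₁.toTopRep) *
        Nat.card A₁ ^ e = Nat.card (continuousCohomology 1 τ₁.toTopRep))
    (h₃ : Nat.card (continuousCohomology 0 τ₃.toTopRep) * Nat.card (continuousCohomology 2 τ₃.toTopRep) *
        Nat.card A₃ ^ e = Nat.card (continuousCohomology 1 τ₃.toTopRep)) :
    Nat.card (continuousCohomology 0 τ₂.toTopRep) * Nat.card (continuousCohomology 2 τ₂.toTopRep) *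
        Nat.card A₂ ^ e = Nat.card (continuousCohomology 1 τ₂.toTopRep) := by
  haveI := subsingleton_continuousCohomology_of_isPrimaryTorsion_of_isTotallyComplex S p hSp τ₁ hA₁
    (by norm_num : 2 < 3)
  exact h.euler_X₂ e h₁ h₃

end GSCurrency

end Literature.NumberTheory.GaloisCohomology

end
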